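import Summits.QuantumAdvantage.QuantumAdvantage.Theses.WhiteBoxWalk
import Literature.Computability.Cryptography.Indistinguishability
import Literature.Computability.Cryptography.IndistinguishabilityObfuscatorSubexp
import Literature.Computability.Cryptography.PuncturablePRF
import Literature.Computability.QuantumComplexity.GluedTrees

/-!
# Sketch for crux idea `renaming-chain-invariance` (crux `WbwObfuscatedGluedTrees`, item stmt-QuantumAdvantage-2340)

Ideator 2, round 1.  Typed objects:

* `ClauseC gen ans` — clause (C) of `WbwThesis` abstracted (verbatim conjunct), with
  `wbwThesis_iff` (`Iff.rfl`) showing the abstraction is faithful.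
* `instAnsEnsemble gen ans` — the instance–answer ensemble `n ↦ law of ⟨gen s, ans s⟩, s ← U_n`.
* `ClauseCTransfer` — FIRST LEMMA of the line: clause (C) transfers along computational
  indistinguishability of instance–answer ensembles (the success event is efficiently testable).
* `HybridChainLemma` — the exponential-length hybrid lemma with a UNIFORM per-step bound
  (telescoping), the form in which sub-exponential `(t, δ)`-security is consumed by a renaming chain
  of `3 · |V(G'_d)| = 3 · (2^{d+2} - 2)` steps.
* `RenamingStep` — the shape of ONE renaming step as a statement about two abstract namings of the
  same labelled graph: stated over an abstract "named succinct graph" record so that it elaborates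
  before `obfuscatedGluedTreesGen` lands; it is the per-step hypothesis fed to `HybridChainLemma`.

Nothing here is proved except `wbwThesis_iff`; these are the signatures the line would prove.
-/

namespace Summit.QuantumAdvantage.QuantumAdvantage.Theses.WhiteBoxWalk.CruxIdeas.RenamingChain

open Literature.Computability.Cryptography Literature.Computability.Complexity Filter Asymptotics

/-- Clause (C) of `WbwThesis`, abstracted: every PPT `A`, given `(1ⁿ, gen s)` for uniform
`s ∈ {0,1}ⁿ`, outputs (a string with prefix) `ans s` with probability superpolynomially small in `n`. -/
def ClauseC (gen ans : List Bool → List Bool) : Prop :=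
  ∀ A : RandAlg (List Bool) (List Bool), IsPPT A id →
    SuperpolynomialDecay atTop (fun n : ℕ => (n : ℝ)) (fun n : ℕ =>
      uniformAvg n fun s => A.pr id (boolPair (Computability.unaryEncodeNat n) (gen s)) {y | ans s <+: y})

/-- The abstraction is faithful: `WbwThesis` is literally `∃ gen ans, FP ∧ length ∧ (Q) ∧ ClauseC`. -/
theorem wbwThesis_iff :
    WbwThesis ↔ ∃ (gen ans : List Bool → List Bool), PolyTimeComputable id id gen ∧
      (∃ p : Polynomial ℕ, ∀ s, (ans s).length = p.eval (gen s).length) ∧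
      (∃ F : QCircuitFamily cliffordT, F.IsOracleFree ∧ F.IsUniform ∧
        ∀ s, 2 / 3 ≤ F.kernelProb 0 (gen s) {y | ans s <+: y}) ∧ ClauseC gen ans :=
  Iff.rfl

/-- The instance–answer ensemble of a generator: at index `n`, the law of the self-delimiting pair
`⟨gen s, ans s⟩` for `s ← U_n`.  A distinguisher receives `(1ⁿ, ⟨gen s, ans s⟩)` (cf. `acceptPMF`). -/
noncomputable def instAnsEnsemble (gen ans : List Bool → List Bool) : Ensemble (List Bool) :=
  fun n => (uniformBits n).map fun s => boolPair (gen s) (ans s)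

/-- **First lemma (transfer backbone).**  If the instance–answer ensembles of `(gen, ans)` and
`(gen', ans')` are computationally indistinguishable, then clause (C) for `(gen, ans)` gives clause
(C) for `(gen', ans')`: an adversary `A'` for the primed pair yields the PPT distinguisher
`z = ⟨x, y⟩ ↦ [y <+: A'(1ⁿ, x)]`, whose acceptance probability is `A'`'s success on either pair. -/
def ClauseCTransfer : Prop :=
  ∀ gen ans gen' ans' : List Bool → List Bool,
    IsCompIndistinguishable (instAnsEnsemble gen ans) (instAnsEnsemble gen' ans') →
    ClauseC gen ans → ClauseC gen' ans'

/-- **Exponential hybrid lemma with a uniform per-step bound.**  A doubly indexed family of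
hybrids `H n i` (`i ≤ M n` at level `n`) whose consecutive members every PPT distinguisher tells
apart with advantage `≤ δ n` for all large `n`, UNIFORMLY in `i`, has computationally
indistinguishable ends as soon as `M n · δ n` is negligible (telescoping sum).  With
`M n = 3 · 2^{d(n)+2}` renaming steps and `δ n = 2 · 2^{-κ(n)^ε}` from `(2^{κ^ε}, 2^{-κ^ε})`-secure
iO and puncturable PRFs (`IsSubexpIO`, `IsTDSecurePuncturablePRF`), this needs `κ(n)^ε ≫ d(n)`. -/
def HybridChainLemma : Prop :=
  ∀ (H : ℕ → ℕ → PMF (List Bool)) (M : ℕ → ℕ) (δ : ℕ → ℝ),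
    SuperpolynomialDecay atTop (fun n : ℕ => (n : ℝ)) (fun n => (M n : ℝ) * δ n) →
    (∀ D : RandAlg (List Bool) Bool, IsPPT D _root_.Computability.encodeBool →
      ∀ᶠ n in atTop, ∀ i, i < M n →
        |(acceptPMF D n (H n i) true).toReal - (acceptPMF D n (H n (i + 1)) true).toReal| ≤ δ n) →
    IsCompIndistinguishable (fun n => H n 0) (fun n => H n (M n))

/-- An abstract NAMED SUCCINCT GRAPH presentation at one security level: a label type with a linear
order (the renaming order), a neighbour map on labels (the fixed graph `G'_d(σ_k)`), two injective
namings `ν₀ ν₁` (e.g. SIV names under key `k` and level-constrained GGM names under key `k'`), and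
the instance sampler producing the adversary's view `⟨code of iO(N), name of ENTRANCE⟩` together with
the answer `name of EXIT` when labels `< i` are named by `ν₁` and labels `≥ i` by `ν₀`
(hybrid `i`).  Only the SHAPE is fixed here; the concrete record is built from
`obfuscatedGluedTreesGen` once that definition lands. -/
structure NamedGraphHybrids where
  /-- number of hybrid positions (`= |V| + 1` per swap phase) at level `n` -/
  M : ℕ → ℕ
  /-- hybrid `i` at level `n`: law of `⟨⟨iO(N^{(i)}), name^{(i)}(ENT)⟩, name^{(i)}(EXIT)⟩` -/
  hyb : ℕ → ℕ → PMF (List Bool)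

/-- **One renaming step (shape).**  The per-step hypothesis of the chain: consecutive hybrids of a
`NamedGraphHybrids` family are `δ`-close for every PPT distinguisher, eventually in `n`, uniformly in
the position.  In the line this is discharged in three sub-steps per label `v`:
(a) puncture the old naming key at `v` and hardwire `ν₀ v` at its ≤ 4 use sites (input check of `v`,
outputs at its ≤ 3 neighbours) — functionally identical, `IsSubexpIO`;
(b) swap the hardwired `ν₀ v` for a fresh uniform string — punctured pseudorandomness
(`IsTDSecurePuncturablePRF`), legitimate at a KNOWN label because only a VALUE changes;
(c) swap the uniform string for `ν₁ v` and un-puncture the new key — the same two facts backwards. -/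
def RenamingStep (F : NamedGraphHybrids) (δ : ℕ → ℝ) : Prop :=
  ∀ D : RandAlg (List Bool) Bool, IsPPT D _root_.Computability.encodeBool →
    ∀ᶠ n in atTop, ∀ i, i < F.M n →
      |(acceptPMF D n (F.hyb n i) true).toReal - (acceptPMF D n (F.hyb n (i + 1)) true).toReal| ≤ δ n

/-- The chain assembled: renaming steps with a negligible total `M · δ` make the two end
instance–answer ensembles indistinguishable (by `HybridChainLemma`), hence clause (C) transfers
between the two namings (by `ClauseCTransfer`).  Stated as the implication the line proves. -/
def NamingInvariance (F : NamedGraphHybrids) (δ : ℕ → ℝ)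
    (gen₀ ans₀ gen₁ ans₁ : List Bool → List Bool) : Prop :=
  (∀ n, F.hyb n 0 = instAnsEnsemble gen₀ ans₀ n) →
  (∀ n, F.hyb n (F.M n) = instAnsEnsemble gen₁ ans₁ n) →
  SuperpolynomialDecay atTop (fun n : ℕ => (n : ℝ)) (fun n => (F.M n : ℝ) * δ n) →
  RenamingStep F δ → (ClauseC gen₀ ans₀ ↔ ClauseC gen₁ ans₁)

end Summit.QuantumAdvantage.QuantumAdvantage.Theses.WhiteBoxWalk.CruxIdeas.RenamingChain
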